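import Mathlib
import Summits.ValiantsHypothesis.ValiantsHypothesis.Theorems.ProofCarryingSymmetryRestorationQPConstNormAC
import Summits.ValiantsHypothesis.ValiantsHypothesis.Theorems.ProofCarryingSymmetryRestorationQPConstNormSubs
import Summits.ValiantsHypothesis.ValiantsHypothesis.Theorems.ProofCarryingSymmetryRestorationQPDistOne

/-!
# Route ProofCarryingSymmetry — crux `RestorationQP`, line `registered`: e-saturated normal forms (definitions)

Support file for the crux item `stmt-ValiantsHypothesis-10343` (lead c5, cycle 5).  The first open
graded instance of the bet S2⁗ is stability at distributivity budget ONE, reduced by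
`stabilityAtDistOne_of_core` (p167773) to its combinatorial core: formulas congruent modulo the
distributivity-free fragment `UCEq` AND ONE GROUND EQUATION `e : P·(Q+R) = P·Q + P·R`
(`ACStability.UCEqWith e`).  The Church–Rosser property needed for one ground instance is obtained
SEMANTICALLY, by a homomorphism into e-SATURATED constant-normal forms — no termination or
confluence argument: this file defines the saturation map, the later parts prove that it respects
`UCEqWith e` (for a GENERIC instance: `P`, `Q`, `R` not constant modulo `UCEq`), commutes with
renaming, preserves the computed polynomial and has few reachable AC-classes, whence an
`S_n`-symmetric circuit whenever the instance is `S_n`-invariant.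

* `DistData` — the three formulas `P, Q, R` of a ground distributivity instance; derived data: the
  constant-normal forms `p, q, r`, `s = cnorm (Q+R)`, the constant `cP` and the pure factors `patF`
  of `p`, the PATTERN `pat = patF ⊎ {s}` (a multiset of AC-classes), the EXPANSION
  `sig = cnorm (P·Q + P·R)`, the ground equation `eqn`, and genericity `Generic` (each of `p, q, r`
  has a variable leaf, `nvars`);
* `kmax K D` — the largest `k` with `k • D ≤ K` (multisets); `removeBy l M` — delete from a list of
  formulas, left to right, one formula of each class in `M` (with multiplicity); `olist` — the
  left-nested product of a list;
* `epeel d x` — PEELING at the root of a normal product `x = m · c`: if `k = kmax (classes of the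
  factors of m) pat ≥ 1`, remove `k` copies of the pattern from the factors, append `k` copies of
  `sig`, and divide the constant by `cP ^ k` (over a field); otherwise `x` unchanged;
* `emul d a b = epeel d (smul a b)` and the e-SATURATION `esat d : PIFormula → PIFormula`
  (smart sums, peeled smart products, bottom-up); `margs`/`mset`/`mcst` read the root factors and
  constant of a normal form; `esatClass d C` is the class of the saturated unfolding of a circuit.

Everything here is a definition or a one-line unfolding lemma; the theory is in the later parts.
-/

-- single-problem summit: `Summit.ValiantsHypothesis.ValiantsHypothesis.…` is the namespace by design (D-0017)
set_option linter.dupNamespace false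

noncomputable section

open scoped Classical

namespace Summit.ValiantsHypothesis.ValiantsHypothesis.Theorems

namespace ACStability

open Literature.Computability.AlgebraicComplexity ACClass

universe u v w

variable {𝔽 : Type u} {X : Type v} {Y : Type w}

/-! ### Leaf counts -/

/-- The number of variable leaves of a formula. [folklore] -/
def nvars : PIFormula 𝔽 X → ℕ
  | .var _ => 1
  | .const _ => 0
  | .add F G => nvars F + nvars G
  | .mul F G => nvars F + nvars G

/-- Unfolding of `nvars`. [folklore] -/
@[simp] theorem nvars_var (x : X) : nvars (.var x : PIFormula 𝔽 X) = 1 := rfl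
/-- Unfolding of `nvars`. [folklore] -/
@[simp] theorem nvars_const (c : 𝔽) : nvars (.const c : PIFormula 𝔽 X) = 0 := rfl
/-- Unfolding of `nvars`. [folklore] -/
@[simp] theorem nvars_add (F G : PIFormula 𝔽 X) : nvars (.add F G) = nvars F + nvars G := rfl
/-- Unfolding of `nvars`. [folklore] -/
@[simp] theorem nvars_mul (F G : PIFormula 𝔽 X) : nvars (.mul F G) = nvars F + nvars G := rfl

/-- Renaming preserves the number of variable leaves. [folklore] -/
@[simp] theorem nvars_rename (f : X → Y) (F : PIFormula 𝔽 X) : nvars (F.rename f) = nvars F := by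
  induction F with
  | var x => rfl
  | const c => rfl
  | add F G ihF ihG => simp [PIFormula.rename, ihF, ihG]
  | mul F G ihF ihG => simp [PIFormula.rename, ihF, ihG]

/-- AC-equivalent formulas have the same number of variable leaves. [folklore] -/
theorem ACEq.nvars_eq {F G : PIFormula 𝔽 X} (h : ACEq F G) : nvars F = nvars G := by
  induction h with
  | refl F => rfl
  | symm _ ih => exact ih.symm
  | trans _ _ ih₁ ih₂ => exact ih₁.trans ih₂
  | add_congr _ _ ih₁ ih₂ => simp [ih₁, ih₂]
  | mul_congr _ _ ih₁ ih₂ => simp [ih₁, ih₂]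
  | add_comm F G => simp [Nat.add_comm]
  | add_assoc F G H => simp [Nat.add_assoc]
  | mul_comm F G => simp [Nat.add_comm]
  | mul_assoc F G H => simp [Nat.add_assoc]

namespace ACClass

/-- The number of variable leaves of a class (well defined by `ACEq.nvars_eq`). [folklore] -/
def nvars : ACClass 𝔽 X → ℕ :=
  Quotient.lift ACStability.nvars fun _ _ h => h.nvars_eq

/-- `nvars` on a representative. [folklore] -/
@[simp] theorem nvars_mk (F : PIFormula 𝔽 X) : (mk F).nvars = ACStability.nvars F := rfl

end ACClass

/-! ### Multiset arithmetic: maximal peeling count -/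

/-- `kmax K D`: the largest `k` with `k • D ≤ K` (for `D ≠ 0`; `0` if `D = 0`). [folklore] -/
def kmax {α : Type*} (K D : Multiset α) : ℕ :=
  if h : D.toFinset.Nonempty then D.toFinset.inf' h (fun d => K.count d / D.count d) else 0

/-! ### Lists of factors -/

/-- Delete from `l`, left to right, one formula of each class in `M` (with multiplicity). [folklore] -/
def removeBy : List (PIFormula 𝔽 X) → Multiset (ACClass 𝔽 X) → List (PIFormula 𝔽 X)
  | [], _ => []
  | f :: l, M => if mk f ∈ M then removeBy l (M.erase (mk f)) else f :: removeBy l M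

/-- Unfolding of `removeBy`. [folklore] -/
@[simp] theorem removeBy_nil (M : Multiset (ACClass 𝔽 X)) : removeBy ([] : List (PIFormula 𝔽 X)) M = [] := rfl

/-- Unfolding of `removeBy` at a deleted head. [folklore] -/
theorem removeBy_cons_of_mem {f : PIFormula 𝔽 X} {M : Multiset (ACClass 𝔽 X)} (h : mk f ∈ M)
    (l : List (PIFormula 𝔽 X)) : removeBy (f :: l) M = removeBy l (M.erase (mk f)) := by
  simp [removeBy, h]

/-- Unfolding of `removeBy` at a kept head. [folklore] -/
theorem removeBy_cons_of_not_mem {f : PIFormula 𝔽 X} {M : Multiset (ACClass 𝔽 X)} (h : mk f ∉ M)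
    (l : List (PIFormula 𝔽 X)) : removeBy (f :: l) M = f :: removeBy l M := by
  simp [removeBy, h]

/-- Nothing to delete. [folklore] -/
@[simp] theorem removeBy_zero (l : List (PIFormula 𝔽 X)) : removeBy l 0 = l := by
  induction l with
  | nil => rfl
  | cons f l ih => simp [removeBy, ih]

/-- The left-nested product of a list of formulas (`none` for the empty list). [folklore] -/
def olist : List (PIFormula 𝔽 X) → Option (PIFormula 𝔽 X)
  | [] => none
  | u :: us => some (prodL u us)

/-- Unfolding of `olist`. [folklore] -/
@[simp] theorem olist_nil : olist ([] : List (PIFormula 𝔽 X)) = none := rfl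
/-- Unfolding of `olist`. [folklore] -/
@[simp] theorem olist_cons (u : PIFormula 𝔽 X) (us : List (PIFormula 𝔽 X)) :
    olist (u :: us) = some (prodL u us) := rfl

/-- The flattened factors of an optional pure part (`[]` for `none`). [folklore] -/
def omulArgs : Option (PIFormula 𝔽 X) → List (PIFormula 𝔽 X)
  | none => []
  | some m => mulArgs m

/-- Unfolding of `omulArgs`. [folklore] -/
@[simp] theorem omulArgs_none : omulArgs (none : Option (PIFormula 𝔽 X)) = [] := rfl
/-- Unfolding of `omulArgs`. [folklore] -/
@[simp] theorem omulArgs_some (m : PIFormula 𝔽 X) : omulArgs (some m) = mulArgs m := rfl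

section Semiring

variable [CommSemiring 𝔽]

/-- The ROOT FACTORS of a formula read in multiplicative normal shape: the flattened factors of its
non-constant part (`[]` for a bare constant). [folklore] -/
def margs (x : PIFormula 𝔽 X) : List (PIFormula 𝔽 X) := omulArgs (msplit x).1

/-- The root factors as a multiset of classes. [folklore] -/
def mset (x : PIFormula 𝔽 X) : Multiset (ACClass 𝔽 X) := ((margs x).map mk : List (ACClass 𝔽 X))

/-- The ROOT CONSTANT of a formula read in multiplicative normal shape. [folklore] -/
def mcst (x : PIFormula 𝔽 X) : 𝔽 := (msplit x).2

/-- Unfolding of `margs`. [folklore] -/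
theorem margs_def (x : PIFormula 𝔽 X) : margs x = omulArgs (msplit x).1 := rfl
/-- Unfolding of `mset`. [folklore] -/
theorem mset_def (x : PIFormula 𝔽 X) : mset x = (((margs x).map mk : List (ACClass 𝔽 X)) : Multiset (ACClass 𝔽 X)) := rfl
/-- Unfolding of `mcst`. [folklore] -/
theorem mcst_def (x : PIFormula 𝔽 X) : mcst x = (msplit x).2 := rfl

/-! ### Ground distributivity instances -/

variable (𝔽 X) in
/-- The data of a ground instance `P·(Q+R) = P·Q + P·R` of distributivity. [folklore] -/
structure DistData : Type (max u v) where
  /-- the common factor -/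
  P : PIFormula 𝔽 X
  /-- the first summand -/
  Q : PIFormula 𝔽 X
  /-- the second summand -/
  R : PIFormula 𝔽 X

namespace DistData

variable (d : DistData 𝔽 X)

/-- The ground equation `(P·(Q+R), P·Q + P·R)`. [folklore] -/
def eqn : PIFormula 𝔽 X × PIFormula 𝔽 X := (.mul d.P (.add d.Q d.R), .add (.mul d.P d.Q) (.mul d.P d.R))

omit [CommSemiring 𝔽] in
/-- The ground equation is a distributivity instance. [folklore] -/
theorem isDistInstance_eqn : IsDistInstance d.eqn := ⟨d.P, d.Q, d.R, rfl⟩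

/-- Renaming an instance. [folklore] -/
def rename (f : X → Y) : DistData 𝔽 Y := ⟨d.P.rename f, d.Q.rename f, d.R.rename f⟩

omit [CommSemiring 𝔽] in
/-- Unfolding of `rename`. [folklore] -/
@[simp] theorem rename_P (f : X → Y) : (d.rename f).P = d.P.rename f := rfl
omit [CommSemiring 𝔽] in
/-- Unfolding of `rename`. [folklore] -/
@[simp] theorem rename_Q (f : X → Y) : (d.rename f).Q = d.Q.rename f := rfl
omit [CommSemiring 𝔽] in
/-- Unfolding of `rename`. [folklore] -/
@[simp] theorem rename_R (f : X → Y) : (d.rename f).R = d.R.rename f := rfl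

omit [CommSemiring 𝔽] in
/-- The ground equation of a renamed instance. [folklore] -/
theorem eqn_rename (f : X → Y) :
    (d.rename f).eqn = (d.eqn.1.rename f, d.eqn.2.rename f) := rfl

/-- The constant-normal form of `P`. [folklore] -/
def p : PIFormula 𝔽 X := cnorm d.P
/-- The constant-normal form of `Q`. [folklore] -/
def q : PIFormula 𝔽 X := cnorm d.Q
/-- The constant-normal form of `R`. [folklore] -/
def r : PIFormula 𝔽 X := cnorm d.R
/-- The constant-normal form of `Q + R`. [folklore] -/
def s : PIFormula 𝔽 X := sadd d.q d.r

/-- `s` is the normal form of `Q + R`. [folklore] -/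
theorem s_eq : d.s = cnorm (.add d.Q d.R) := rfl

/-- The root constant of `p`. [folklore] -/
def cP : 𝔽 := mcst d.p

/-- The PURE FACTORS of `p` (its root factors). [folklore] -/
def patF : List (PIFormula 𝔽 X) := margs d.p

/-- The PATTERN: the classes of the pure factors of `p` and of `s`. [folklore] -/
def pat : Multiset (ACClass 𝔽 X) :=
  (((d.patF ++ [d.s]).map ACClass.mk : List (ACClass 𝔽 X)) : Multiset (ACClass 𝔽 X))

/-- The class of `s` belongs to the pattern. [folklore] -/
theorem mk_s_mem_pat : ACClass.mk d.s ∈ d.pat := by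
  simp [pat]

/-- The pattern is not empty. [folklore] -/
theorem pat_ne_zero : d.pat ≠ 0 := fun h => by
  have := d.mk_s_mem_pat
  rw [h] at this
  exact Multiset.notMem_zero _ this

/-- The EXPANSION `sig = cnorm (P·Q + P·R)` — what one peeled copy of the pattern becomes. [folklore] -/
def sig : PIFormula 𝔽 X := sadd (smul d.p d.q) (smul d.p d.r)

/-- `sig` is the normal form of `P·Q + P·R`. [folklore] -/
theorem sig_eq : d.sig = cnorm (.add (.mul d.P d.Q) (.mul d.P d.R)) := rfl

/-- The leaf weight of the pattern: `nvars p + nvars s`. [folklore] -/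
def patVars : ℕ := nvars d.p + nvars d.s

/-- GENERICITY of an instance `d'`: each of `P`, `Q`, `R` keeps a variable leaf after constant
folding (none of them is a constant modulo `UCEq`). [folklore] -/
def Generic (d' : DistData 𝔽 X) : Prop := 1 ≤ nvars d'.p ∧ 1 ≤ nvars d'.q ∧ 1 ≤ nvars d'.r

end DistData

end Semiring

section Field

variable [Field 𝔽]

/-- **Peeling at the root.**  Read `x` in multiplicative normal shape `m · c`; with
`k = kmax (classes of the factors of m) pat`: if `k = 0` (in particular for a bare constant) return
`x`; otherwise delete `k` copies of the pattern from the factors, append `k` copies of the expansion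
`sig`, re-nest, and carry the constant `c · cP⁻¹ ^ k`. [folklore] -/
def epeel (d : DistData 𝔽 X) (x : PIFormula 𝔽 X) : PIFormula 𝔽 X :=
  if kmax (mset x) d.pat = 0 then x
  else mmk (olist (removeBy (margs x) (kmax (mset x) d.pat • d.pat) ++
      List.replicate (kmax (mset x) d.pat) d.sig)) (mcst x * d.cP⁻¹ ^ kmax (mset x) d.pat)

/-- Unfolding of `epeel` when nothing peels. [folklore] -/
theorem epeel_of_kmax_eq_zero (d : DistData 𝔽 X) {x : PIFormula 𝔽 X} (h : kmax (mset x) d.pat = 0) :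
    epeel d x = x := if_pos h

/-- Unfolding of `epeel` when `k ≥ 1` copies of the pattern peel. [folklore] -/
theorem epeel_of_kmax_ne_zero (d : DistData 𝔽 X) {x : PIFormula 𝔽 X} (h : kmax (mset x) d.pat ≠ 0) :
    epeel d x = mmk (olist (removeBy (margs x) (kmax (mset x) d.pat • d.pat) ++
      List.replicate (kmax (mset x) d.pat) d.sig)) (mcst x * d.cP⁻¹ ^ kmax (mset x) d.pat) := if_neg h

/-- **The peeled smart product.** [folklore] -/
def emul (d : DistData 𝔽 X) (a b : PIFormula 𝔽 X) : PIFormula 𝔽 X := epeel d (smul a b)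

/-- **The e-saturation**: smart sums and peeled smart products, bottom-up. [folklore] -/
def esat (d : DistData 𝔽 X) : PIFormula 𝔽 X → PIFormula 𝔽 X
  | .add F G => sadd (esat d F) (esat d G)
  | .mul F G => emul d (esat d F) (esat d G)
  | F => F

/-- Unfolding of `esat`. [folklore] -/
@[simp] theorem esat_var (d : DistData 𝔽 X) (x : X) : esat d (.var x) = .var x := rfl
/-- Unfolding of `esat`. [folklore] -/
@[simp] theorem esat_const (d : DistData 𝔽 X) (c : 𝔽) : esat d (.const c) = .const c := rfl
/-- Unfolding of `esat`. [folklore] -/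
@[simp] theorem esat_add (d : DistData 𝔽 X) (F G : PIFormula 𝔽 X) :
    esat d (.add F G) = sadd (esat d F) (esat d G) := rfl
/-- Unfolding of `esat`. [folklore] -/
@[simp] theorem esat_mul (d : DistData 𝔽 X) (F G : PIFormula 𝔽 X) :
    esat d (.mul F G) = emul d (esat d F) (esat d G) := rfl

/-- The class of the e-saturated unfolding of a circuit. [folklore] -/
def esatClass (d : DistData 𝔽 X) (C : PICircuit 𝔽 X) : ACClass 𝔽 X := mk (esat d C.unfold)

end Field

end ACStability

end Summit.ValiantsHypothesis.ValiantsHypothesis.Theorems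

end
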